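import Literature.Analysis.FluidPDE.PeriodicLerayGalerkinBasis
import Literature.Analysis.FluidPDE.PeriodicLerayLimitWeakForm
import Literature.Analysis.FluidPDE.NSGaldiExtendedTest
import Mathlib.Analysis.SpecialFunctions.Trigonometric.Deriv
import Mathlib.Algebra.Order.ToIntervalMod
import HarnessLib

/-!
# [BT1] the Galerkin limit: approximation of the periodic divergence-free test fields `𝒟_T` by
  test fields with values in the Galerkin spaces

Analysis/FluidPDE proof file (theorems only; no definitions, no named facts) in the DAG below the
named fact `Literature.Analysis.FluidPDE.bradshawTsai2017_thm_2_4_mollified`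
(`PeriodicLerayExistence.lean`; Bradshaw–Tsai, Ann. Henri Poincaré 18 (2017) = arXiv:1510.07504
[BT1], proof of Thm 2.4: the weak formulation "holds for all `f ∈ 𝒟_T`" is obtained for the
limit of the Galerkin approximants "through a standard limiting process"; Temam, *Navier–Stokes
equations*, Ch. III §3, (3.50)–(3.52): passage to the limit for tests `ψ(t) wⱼ` and "by a
density argument"). The limit equation is first available for test fields of the form
`Σⱼ cⱼ(s) gⱼ` with `gⱼ` in a Galerkin space `V_m = span{σ₀, …, σ_m}` and `cⱼ` smooth
`T`-periodic; this file proves that **every `f ∈ 𝒟_T` is approximated by such fields, uniformly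
together with `∂ₛf` and `D_y f`, with supports in a common ball** (`exists_galerkin_test_approx`),
which is what the continuity of the weak formulation in these norms consumes.

Construction (elementary, no Fourier series): a smooth nonnegative `T`-periodic kernel
`k_n(x) = (1 + cos(2πx/T))ⁿ / Z_n` of unit mass over a period concentrates at `0`
(`k_n`-mass of `η ≤ |x| ≤ T/2` is `≤ (T/η) rⁿ`, `r < 1`); the time convolution
`∫₀ᵀ k_n(s − τ) f(τ) dτ` approximates `f` uniformly (with `∂ₛ`, `D_y`: integration by parts in `τ`
and the same estimate for `∂ₛf`, `D_y f`); its Riemann sums `Σ_l (T/L) k_n(s − lT/L) f(lT/L)` over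
`L` nodes approximate it uniformly for `L` large (`C¹` dependence on `τ`); and each node value
`f(lT/L) ∈ 𝒱` is replaced by a `C¹`-close member `σ_{n_l}` of the dense family of
`PeriodicLerayGalerkinBasis` with the same support ball.

## Main statements (all proved)

* `norm_riemannSum_sub_integral_le` — `‖Σ_l h φ(lh) − ∫₀ᵀ φ‖ ≤ M T h` for `‖φ'‖ ≤ M`, `h = T/L`;
* `cosPow_*`, `mul_cosPow_le_integral`, `cosPow_div_le_of_le_abs`, `cosRatio_lt_one` —
  smoothness, periodicity, positivity, the lower bound of the normalising integral and the tail
  bound of the kernel;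
* `norm_integral_cosKernel_smul_sub_le` — the approximate-identity estimate for continuous
  periodic `u` (`‖k_n ⊛ u − u‖ ≤ ε + 2M T rⁿ/η`);
* `exists_forall_norm_sub_le_of_periodic₂`, `norm_riemannSum_kernel_sub_integral_le`,
  `integral_deriv_kernel_smul_eq` — uniform continuity in time, Riemann sums with a kernel,
  integration by parts over a period for smooth space–time fields;
* `exists_galerkin_test_approx` — **the approximation of `𝒟_T` by `V_m`-valued test fields**.

## Mathlib / tree search

Tree (all used): `IsPeriodicDivFreeTest` (`PeriodicLeraySystem`); `testDivFreeSubmodule`,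
`galerkinSpace`, `mem_galerkinSpace`, `galerkinSpace_le`, `exists_countable_dense_testDivFree`
(the density property, as a hypothesis) (`PeriodicLerayGalerkinBasis`);
`exists_global_bound_of_periodic` (`PeriodicLerayLimitWeakForm`);
`exists_bound_of_continuous_periodic` (`PeriodicLerayGalerkinSystem`);
`contDiff_slice_of_contDiff_uncurry`, `contDiff_uncurry_fderiv_slice`,
`contDiff_uncurry_timeDeriv` (`NSGaldiExtendedTest`). Mathlib: `intervalIntegral` FTC / sums over
adjacent intervals / `integral_comp_sub_left`, `Function.Periodic.intervalIntegral_add_eq`,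
`Convex.norm_image_sub_le_of_norm_deriv_le`, `Real.cos_le_cos_of_nonneg_of_le_pi`,
`exists_pow_lt_of_lt_one`, `toIcoDiv`, `ContDiff.iterate_deriv`, `HasFDerivAt.sum`,
`HasDerivAt.sum`. No Fejér/Fourier series is used.

## References

* Z. Bradshaw, T.-P. Tsai, Ann. Henri Poincaré 18 (2017) = arXiv:1510.07504, proof of Thm 2.4
  [BradshawTsai2017AHP].
* R. Temam, *Navier–Stokes equations* (1977/79), Ch. III §3, (3.50)–(3.52) [Temam1979].
-/

noncomputable section

open MeasureTheory Set Function Filter Topology TopologicalSpace Metric Module intervalIntegral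
open scoped NNReal ENNReal InnerProductSpace RealInnerProductSpace Real Interval

namespace Literature.Analysis.FluidPDE

namespace BradshawTsai2017

/-! ### Riemann sums of `C¹` functions over a period -/

section Riemann

variable {E : Type*} [NormedAddCommGroup E] [NormedSpace ℝ E] [CompleteSpace E]

/-- **Left Riemann sums of a `C¹` function over `[0, T]`**: with `h = T/L` and nodes `lh`,
`‖Σ_{l<L} h • φ(lh) − ∫₀ᵀ φ‖ ≤ M T h` whenever `‖φ'‖ ≤ M` on `ℝ`. [folklore] -/
theorem norm_riemannSum_sub_integral_le {φ : ℝ → E} (hφ : Differentiable ℝ φ) {M : ℝ}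
    (hM : ∀ x, ‖deriv φ x‖ ≤ M) {T : ℝ} (hT : 0 < T) {L : ℕ} (hL : 0 < L) :
    ‖(∑ l ∈ Finset.range L, (T / L) • φ (l * (T / L))) - ∫ x in (0 : ℝ)..T, φ x‖ ≤
      M * T * (T / L) := by
  set h : ℝ := T / L with hh
  have hL' : (0 : ℝ) < L := Nat.cast_pos.2 hL
  have hh0 : 0 < h := div_pos hT hL'
  have hM0 : 0 ≤ M := (norm_nonneg _).trans (hM 0)
  have hcont : Continuous φ := hφ.continuous
  -- the integral as a sum over the cells
  have hsplit : ∫ x in (0 : ℝ)..T, φ x = ∑ l ∈ Finset.range L, ∫ x in (l * h)..((l + 1 : ℕ) * h), φ x := by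
    have e := sum_integral_adjacent_intervals (f := φ) (μ := volume) (a := fun l : ℕ => (l : ℝ) * h)
      (n := L) fun k _ => (hcont.intervalIntegrable _ _)
    simp only [Nat.cast_zero, zero_mul] at e
    have hTL : (L : ℝ) * h = T := by rw [hh]; field_simp
    rw [← hTL, ← e]
  -- each cell
  have hcell : ∀ l : ℕ, ‖h • φ (l * h) - ∫ x in (l * h)..((l + 1 : ℕ) * h), φ x‖ ≤ M * h * h := by
    intro l
    have e1 : ((l + 1 : ℕ) : ℝ) * h = l * h + h := by push_cast; ring
    rw [e1]
    have e2 : h • φ (l * h) = ∫ x in (l * h)..(l * h + h), φ (l * h) := by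
      rw [intervalIntegral.integral_const]; simp
    rw [e2, ← intervalIntegral.integral_sub intervalIntegrable_const (hcont.intervalIntegrable _ _)]
    have hb : ∀ x ∈ Ι (l * h) (l * h + h), ‖φ (l * h) - φ x‖ ≤ M * h := by
      intro x hx
      rw [uIoc_of_le (by linarith)] at hx
      have hmvt : ‖φ x - φ (l * h)‖ ≤ M * ‖x - l * h‖ :=
        (convex_univ).norm_image_sub_le_of_norm_deriv_le (fun y _ => hφ y) (fun y _ => hM y)
          (mem_univ _) (mem_univ _)
      rw [norm_sub_rev]
      refine hmvt.trans ?_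
      rw [Real.norm_eq_abs, abs_of_nonneg (by linarith [hx.1])]
      exact mul_le_mul_of_nonneg_left (by linarith [hx.2]) hM0
    refine (intervalIntegral.norm_integral_le_of_norm_le_const hb).trans ?_
    rw [show l * h + h - l * h = h by ring, abs_of_pos hh0]
  calc ‖(∑ l ∈ Finset.range L, h • φ (l * h)) - ∫ x in (0 : ℝ)..T, φ x‖
      = ‖∑ l ∈ Finset.range L, (h • φ (l * h) - ∫ x in (l * h)..((l + 1 : ℕ) * h), φ x)‖ := by
        rw [hsplit, Finset.sum_sub_distrib]
    _ ≤ ∑ l ∈ Finset.range L, ‖h • φ (l * h) - ∫ x in (l * h)..((l + 1 : ℕ) * h), φ x‖ :=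
        norm_sum_le _ _
    _ ≤ ∑ _l ∈ Finset.range L, M * h * h := Finset.sum_le_sum fun l _ => hcell l
    _ = M * T * h := by
        rw [Finset.sum_const, Finset.card_range, nsmul_eq_mul, hh]
        field_simp

end Riemann

/-! ### The kernel `k_n(x) = (1 + cos(2πx/T))ⁿ / Z_n` -/

section Kernel

variable {T : ℝ} {n : ℕ}

/-- The unnormalised kernel `(1 + cos(2πx/T))ⁿ` is smooth. [folklore] -/
theorem contDiff_cosPow (T : ℝ) (n : ℕ) :
    ContDiff ℝ (⊤ : ℕ∞) fun x : ℝ => (1 + Real.cos (2 * π * x / T)) ^ n :=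
  (contDiff_const.add (Real.contDiff_cos.comp ((contDiff_const.mul contDiff_id).div_const _))).pow n

/-- The unnormalised kernel is `T`-periodic. [folklore] -/
theorem cosPow_periodic (hT : T ≠ 0) (n : ℕ) :
    Function.Periodic (fun x : ℝ => (1 + Real.cos (2 * π * x / T)) ^ n) T := fun x => by
  have e : 2 * π * (x + T) / T = 2 * π * x / T + 2 * π := by field_simp
  simp only [e, Real.cos_add_two_pi]

/-- The unnormalised kernel is nonnegative. [folklore] -/
theorem cosPow_nonneg (T : ℝ) (n : ℕ) (x : ℝ) : 0 ≤ (1 + Real.cos (2 * π * x / T)) ^ n :=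
  pow_nonneg (by linarith [Real.neg_one_le_cos (2 * π * x / T)]) n

/-- The unnormalised kernel is at most `2ⁿ`. [folklore] -/
theorem cosPow_le (T : ℝ) (n : ℕ) (x : ℝ) : (1 + Real.cos (2 * π * x / T)) ^ n ≤ 2 ^ n :=
  pow_le_pow_left₀ (by linarith [Real.neg_one_le_cos (2 * π * x / T)])
    (by linarith [Real.cos_le_one (2 * π * x / T)]) n

/-- **Monotonicity in `|x|` on the half period**: for `|x| ≤ a ≤ T/2`,
`(1 + cos(2πa/T))ⁿ ≤ (1 + cos(2πx/T))ⁿ` (the cosine decreases on `[0, π]`). [folklore] -/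
theorem cosPow_anti (hT : 0 < T) (n : ℕ) {x a : ℝ} (hxa : |x| ≤ a) (ha : a ≤ T / 2) :
    (1 + Real.cos (2 * π * a / T)) ^ n ≤ (1 + Real.cos (2 * π * x / T)) ^ n := by
  have h0 : 0 ≤ |x| := abs_nonneg x
  have hcos : Real.cos (2 * π * a / T) ≤ Real.cos (2 * π * x / T) := by
    rw [← Real.cos_abs (2 * π * x / T)]
    have e : |2 * π * x / T| = 2 * π * |x| / T := by
      rw [abs_div, abs_mul, abs_of_pos hT, abs_of_pos (by positivity : (0:ℝ) < 2 * π)]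
    rw [e]
    refine Real.cos_le_cos_of_nonneg_of_le_pi (by positivity) ?_ ?_
    · calc 2 * π * a / T ≤ 2 * π * (T / 2) / T := by gcongr
        _ = π := by field_simp
    · gcongr
  exact pow_le_pow_left₀ (by linarith [Real.neg_one_le_cos (2 * π * a / T)]) (by linarith) n

/-- **Lower bound of the normalising integral**: for `0 < η ≤ T/2`,
`η (1 + cos(πη/T))ⁿ ≤ ∫_{−T/2}^{T/2} (1 + cos(2πx/T))ⁿ dx` (the integrand exceeds
`(1 + cos(πη/T))ⁿ` on `[−η/2, η/2]`). [folklore] -/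
theorem mul_cosPow_le_integral (hT : 0 < T) (n : ℕ) {η : ℝ} (hη : 0 < η) (hηT : η ≤ T / 2) :
    η * (1 + Real.cos (π * η / T)) ^ n ≤
      ∫ x in (-(T / 2))..(T / 2), (1 + Real.cos (2 * π * x / T)) ^ n := by
  have hc : Continuous fun x : ℝ => (1 + Real.cos (2 * π * x / T)) ^ n := (contDiff_cosPow T n).continuous
  calc η * (1 + Real.cos (π * η / T)) ^ n
      = ∫ _x in (-(η / 2))..(η / 2), (1 + Real.cos (2 * π * (η / 2) / T)) ^ n := by
        rw [intervalIntegral.integral_const, smul_eq_mul]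
        have e : 2 * π * (η / 2) / T = π * η / T := by ring
        rw [e]; ring
    _ ≤ ∫ x in (-(η / 2))..(η / 2), (1 + Real.cos (2 * π * x / T)) ^ n := by
        refine intervalIntegral.integral_mono_on (by linarith) intervalIntegrable_const
          (hc.intervalIntegrable _ _) fun x hx => ?_
        exact cosPow_anti hT n (abs_le.2 ⟨by linarith [hx.1], hx.2⟩) (by linarith)
    _ ≤ ∫ x in (-(T / 2))..(T / 2), (1 + Real.cos (2 * π * x / T)) ^ n :=
        intervalIntegral.integral_mono_interval (by linarith) (by linarith) (by linarith)
          (Eventually.of_forall fun x => cosPow_nonneg T n x) (hc.intervalIntegrable _ _)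

/-- The normalising integral over a period is positive. [folklore] -/
theorem cosPow_integral_pos (hT : 0 < T) (n : ℕ) :
    0 < ∫ x in (-(T / 2))..(T / 2), (1 + Real.cos (2 * π * x / T)) ^ n := by
  have h := mul_cosPow_le_integral hT n (half_pos hT) le_rfl
  refine lt_of_lt_of_le ?_ h
  have hc : 0 < 1 + Real.cos (π * (T / 2) / T) := by
    have e : π * (T / 2) / T = π / 2 := by field_simp
    rw [e, Real.cos_pi_div_two]; norm_num
  positivity

/-- **The tail of the normalised kernel**: for `0 < η ≤ T/2` and `η ≤ |x| ≤ T/2`,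
`(1 + cos(2πx/T))ⁿ / Z ≤ rⁿ / η` with `Z = ∫_{−T/2}^{T/2} (1 + cos(2π·/T))ⁿ` and
`r = (1 + cos(2πη/T)) / (1 + cos(πη/T)) < 1`. [folklore] -/
theorem cosPow_div_le_of_le_abs (hT : 0 < T) (n : ℕ) {η : ℝ} (hη : 0 < η) (hηT : η ≤ T / 2)
    {x : ℝ} (hx : η ≤ |x|) (hxT : |x| ≤ T / 2) :
    (1 + Real.cos (2 * π * x / T)) ^ n / (∫ y in (-(T / 2))..(T / 2), (1 + Real.cos (2 * π * y / T)) ^ n) ≤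
      ((1 + Real.cos (2 * π * η / T)) / (1 + Real.cos (π * η / T))) ^ n / η := by
  have hZ := cosPow_integral_pos hT n
  have hden : 0 < 1 + Real.cos (π * η / T) := by
    have h1 : π * η / T ≤ π / 2 := by
      rw [div_le_iff₀ hT]
      nlinarith [Real.pi_pos]
    have h2 : 0 ≤ Real.cos (π * η / T) := Real.cos_nonneg_of_neg_pi_div_two_le_of_le
      (by linarith [Real.pi_pos, (by positivity : 0 ≤ π * η / T)]) h1
    linarith
  -- numerator: `|x| ≥ η` gives `cos(2πx/T) ≤ cos(2πη/T)`
  have hnum : (1 + Real.cos (2 * π * x / T)) ^ n ≤ (1 + Real.cos (2 * π * η / T)) ^ n := by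
    have h := cosPow_anti hT n (x := η) (a := |x|) (by rw [abs_of_pos hη]; exact hx) hxT
    have e : (1 + Real.cos (2 * π * |x| / T)) ^ n = (1 + Real.cos (2 * π * x / T)) ^ n := by
      rw [← Real.cos_abs (2 * π * x / T), abs_div, abs_mul, abs_of_pos hT,
        abs_of_pos (by positivity : (0:ℝ) < 2 * π)]
    rwa [e] at h
  have hlow := mul_cosPow_le_integral hT n hη hηT
  have hB : 0 < (1 + Real.cos (π * η / T)) ^ n := pow_pos hden n
  have hA : 0 ≤ (1 + Real.cos (2 * π * η / T)) ^ n :=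
    pow_nonneg (by linarith [Real.neg_one_le_cos (2 * π * η / T)]) n
  rw [div_pow, div_le_div_iff₀ hZ hη]
  calc (1 + Real.cos (2 * π * x / T)) ^ n * η ≤ (1 + Real.cos (2 * π * η / T)) ^ n * η :=
        mul_le_mul_of_nonneg_right hnum hη.le
    _ = (1 + Real.cos (2 * π * η / T)) ^ n / (1 + Real.cos (π * η / T)) ^ n *
          (η * (1 + Real.cos (π * η / T)) ^ n) := by
        field_simp
    _ ≤ (1 + Real.cos (2 * π * η / T)) ^ n / (1 + Real.cos (π * η / T)) ^ n *
          ∫ y in (-(T / 2))..(T / 2), (1 + Real.cos (2 * π * y / T)) ^ n :=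
        mul_le_mul_of_nonneg_left hlow (div_nonneg hA hB.le)

/-- The tail ratio is `< 1`: `(1 + cos(2πη/T)) / (1 + cos(πη/T)) < 1` for `0 < η ≤ T/2`.
[folklore] -/
theorem cosRatio_lt_one (hT : 0 < T) {η : ℝ} (hη : 0 < η) (hηT : η ≤ T / 2) :
    (1 + Real.cos (2 * π * η / T)) / (1 + Real.cos (π * η / T)) < 1 := by
  have h1 : π * η / T ≤ π / 2 := by
    rw [div_le_iff₀ hT]; nlinarith [Real.pi_pos]
  have h0 : 0 < π * η / T := by positivity
  have h2 : 0 ≤ Real.cos (π * η / T) :=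
    Real.cos_nonneg_of_neg_pi_div_two_le_of_le (by linarith) h1
  have hden : 0 < 1 + Real.cos (π * η / T) := by linarith
  rw [div_lt_one hden]
  have hlt : Real.cos (2 * π * η / T) < Real.cos (π * η / T) := by
    refine Real.cos_lt_cos_of_nonneg_of_le_pi h0.le ?_ (by
      have : π * η / T < 2 * π * η / T :=
        div_lt_div_of_pos_right (by nlinarith [Real.pi_pos]) hT
      exact this)
    calc 2 * π * η / T ≤ 2 * π * (T / 2) / T := by gcongr
      _ = π := by field_simp
  linarith

/-- The tail ratio is nonnegative. [folklore] -/
theorem cosRatio_nonneg (T η : ℝ) :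
    0 ≤ (1 + Real.cos (2 * π * η / T)) / (1 + Real.cos (π * η / T)) :=
  div_nonneg (by linarith [Real.neg_one_le_cos (2 * π * η / T)])
    (by linarith [Real.neg_one_le_cos (π * η / T)])

end Kernel

/-! ### The approximate identity: time convolution with the kernel over a period -/

section ApproxIdentity

variable {E : Type*} [NormedAddCommGroup E] [NormedSpace ℝ E] [CompleteSpace E] {T : ℝ} {n : ℕ}

/-- **The approximate-identity estimate.** Let `u : ℝ → E` be continuous and `T`-periodic with
`‖u‖ ≤ M_u`, let `0 < η ≤ T/2` and suppose `‖u(s − x) − u(s)‖ ≤ ε` for `|x| ≤ η`. Then, with the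
normalised kernel `k_n = (1 + cos(2π·/T))ⁿ / Z_n` (`Z_n` its integral over a period),
`‖∫_{−T/2}^{T/2} k_n(x) u(s − x) dx − u(s)‖ ≤ ε + 2 M_u T rⁿ/η`,
`r = (1 + cos(2πη/T))/(1 + cos(πη/T)) < 1` (split at `|x| = η`; on `|x| ≥ η` the kernel is
`≤ rⁿ/η`). [folklore] -/
theorem norm_integral_cosKernel_smul_sub_le (hT : 0 < T) {u : ℝ → E} (hu : Continuous u)
    {Mu : ℝ} (hMu : ∀ x, ‖u x‖ ≤ Mu) {η : ℝ} (hη : 0 < η) (hηT : η ≤ T / 2) {ε : ℝ} (hε : 0 ≤ ε)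
    (s : ℝ) (hmod : ∀ x, |x| ≤ η → ‖u (s - x) - u s‖ ≤ ε) :
    ‖(∫ x in (-(T / 2))..(T / 2),
        ((1 + Real.cos (2 * π * x / T)) ^ n /
          ∫ y in (-(T / 2))..(T / 2), (1 + Real.cos (2 * π * y / T)) ^ n) • u (s - x)) -
        u s‖ ≤
      ε + 2 * Mu * T * (((1 + Real.cos (2 * π * η / T)) / (1 + Real.cos (π * η / T))) ^ n / η) := by
  set Z : ℝ := ∫ y in (-(T / 2))..(T / 2), (1 + Real.cos (2 * π * y / T)) ^ n with hZ
  set k : ℝ → ℝ := fun x => (1 + Real.cos (2 * π * x / T)) ^ n / Z with hk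
  set ρ : ℝ := ((1 + Real.cos (2 * π * η / T)) / (1 + Real.cos (π * η / T))) ^ n / η with hρ
  have hZpos : 0 < Z := cosPow_integral_pos hT n
  have hMu0 : 0 ≤ Mu := (norm_nonneg _).trans (hMu 0)
  have hρ0 : 0 ≤ ρ := div_nonneg (pow_nonneg (cosRatio_nonneg T η) n) hη.le
  have hkc : Continuous k := (contDiff_cosPow T n).continuous.div_const _
  have hk0 : ∀ x, 0 ≤ k x := fun x => div_nonneg (cosPow_nonneg T n x) hZpos.le
  -- unit mass
  have hmass : ∫ x in (-(T / 2))..(T / 2), k x = 1 := by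
    simp only [hk]
    rw [intervalIntegral.integral_div, div_self hZpos.ne']
  -- `u s = ∫ k • u s`
  have hus : u s = ∫ x in (-(T / 2))..(T / 2), k x • u s := by
    rw [intervalIntegral.integral_smul_const, hmass, one_smul]
  have hcu : Continuous fun x => u (s - x) := hu.comp (continuous_const.sub continuous_id)
  have i1 : IntervalIntegrable (fun x => k x • u (s - x)) volume (-(T / 2)) (T / 2) :=
    (hkc.smul hcu).intervalIntegrable _ _
  have i2 : IntervalIntegrable (fun x => k x • u s) volume (-(T / 2)) (T / 2) :=
    (hkc.smul continuous_const).intervalIntegrable _ _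
  show ‖(∫ x in (-(T / 2))..(T / 2), k x • u (s - x)) - u s‖ ≤ ε + 2 * Mu * T * ρ
  rw [hus, ← intervalIntegral.integral_sub i1 i2]
  -- pointwise bound of the integrand on `[−T/2, T/2]`
  have hpt : ∀ x ∈ Ioc (-(T / 2)) (T / 2), ‖k x • u (s - x) - k x • u s‖ ≤ ε * k x + 2 * Mu * ρ := by
    intro x hx
    have hxT : |x| ≤ T / 2 := abs_le.2 ⟨hx.1.le, hx.2⟩
    rw [← smul_sub, norm_smul, Real.norm_eq_abs, abs_of_nonneg (hk0 x)]
    by_cases hxη : |x| ≤ η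
    · have h := hmod x hxη
      calc k x * ‖u (s - x) - u s‖ ≤ k x * ε := mul_le_mul_of_nonneg_left h (hk0 x)
        _ = ε * k x := mul_comm _ _
        _ ≤ ε * k x + 2 * Mu * ρ := le_add_of_nonneg_right (by positivity)
    · have hge : η ≤ |x| := (not_le.1 hxη).le
      have hkle : k x ≤ ρ := by
        simp only [hk, hρ, hZ]
        exact cosPow_div_le_of_le_abs hT n hη hηT hge hxT
      have hdiff : ‖u (s - x) - u s‖ ≤ 2 * Mu :=
        (norm_sub_le _ _).trans (by linarith [hMu (s - x), hMu s])
      calc k x * ‖u (s - x) - u s‖ ≤ ρ * (2 * Mu) :=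
            mul_le_mul hkle hdiff (norm_nonneg _) hρ0
        _ = 2 * Mu * ρ := by ring
        _ ≤ ε * k x + 2 * Mu * ρ := le_add_of_nonneg_left (mul_nonneg hε (hk0 x))
  calc ‖∫ x in (-(T / 2))..(T / 2), (k x • u (s - x) - k x • u s)‖
      ≤ ∫ x in (-(T / 2))..(T / 2), (ε * k x + 2 * Mu * ρ) := by
        refine intervalIntegral.norm_integral_le_of_norm_le (by linarith) ?_ ?_
        · exact Eventually.of_forall fun x hx => hpt x hx
        · exact ((continuous_const.mul hkc).add continuous_const).intervalIntegrable _ _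
    _ = ε * 1 + (T / 2 - -(T / 2)) * (2 * Mu * ρ) := by
        have i3 : IntervalIntegrable (fun x => ε * k x) volume (-(T / 2)) (T / 2) :=
          (continuous_const.mul hkc).intervalIntegrable _ _
        rw [intervalIntegral.integral_add i3 intervalIntegrable_const,
          intervalIntegral.integral_const_mul, hmass, intervalIntegral.integral_const, smul_eq_mul]
    _ = ε + 2 * Mu * T * ρ := by ring

omit [CompleteSpace E] in
/-- **The periodic convolution over `[0, T]` equals the centred one**: for `T`-periodic `u` and the
`T`-periodic kernel, `∫₀ᵀ k(s − τ) u(τ) dτ = ∫_{−T/2}^{T/2} k(x) u(s − x) dx` (shift of the period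
and the substitution `τ = s − x`). [folklore] -/
theorem integral_cosKernel_comp_sub_smul_eq (hT : 0 < T) {u : ℝ → E} (hper : Function.Periodic u T)
    (c : ℝ) (s : ℝ) :
    ∫ τ in (0 : ℝ)..T, (c * (1 + Real.cos (2 * π * (s - τ) / T)) ^ n) • u τ =
      ∫ x in (-(T / 2))..(T / 2), (c * (1 + Real.cos (2 * π * x / T)) ^ n) • u (s - x) := by
  -- the integrand `τ ↦ k(s − τ) u(τ)` is `T`-periodic
  have hkper := cosPow_periodic hT.ne' n
  have hP : Function.Periodic (fun τ => (c * (1 + Real.cos (2 * π * (s - τ) / T)) ^ n) • u τ) T := by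
    intro τ
    simp only
    rw [hper τ]
    congr 2
    rw [show s - (τ + T) = s - τ - T by ring]
    exact hkper.sub_eq (s - τ)
  -- shift the period to `[s − T/2, s + T/2]`
  have h1 : ∫ τ in (0 : ℝ)..T, (c * (1 + Real.cos (2 * π * (s - τ) / T)) ^ n) • u τ =
      ∫ τ in (s - T / 2)..(s - T / 2 + T), (c * (1 + Real.cos (2 * π * (s - τ) / T)) ^ n) • u τ := by
    have e := hP.intervalIntegral_add_eq 0 (s - T / 2)
    rw [zero_add] at e
    exact e
  rw [h1]
  -- substitution `x = s − τ`
  have h2 := intervalIntegral.integral_comp_sub_left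
    (fun x => (c * (1 + Real.cos (2 * π * x / T)) ^ n) • u (s - x)) s (a := s - T / 2) (b := s - T / 2 + T)
  simp only [sub_sub_cancel] at h2
  rw [h2]
  have e1 : s - (s - T / 2 + T) = -(T / 2) := by ring
  rw [e1]

end ApproxIdentity

/-! ### Smooth periodic space–time fields: time lines, uniform continuity, Riemann sums -/

section Fields

variable {E' : Type*} [NormedAddCommGroup E'] [NormedSpace ℝ E'] [CompleteSpace E'] {T : ℝ}

omit [CompleteSpace E'] in
/-- The time lines of a jointly smooth field are differentiable with derivative `timeDeriv`.
[folklore] -/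
theorem hasDerivAt_timeLine_of_contDiff {Φ : ℝ → EuclideanSpace ℝ (Fin 3) → E'}
    (hΦ : ContDiff ℝ (⊤ : ℕ∞) (uncurry Φ)) (τ : ℝ) (y : EuclideanSpace ℝ (Fin 3)) :
    HasDerivAt (fun t => Φ t y) (timeDeriv Φ τ y) τ := by
  have hd : Differentiable ℝ fun t => Φ t y :=
    (hΦ.differentiable (by simp)).comp (differentiable_id.prodMk (differentiable_const y))
  rw [timeDeriv]
  exact (hd τ).hasDerivAt

omit [NormedSpace ℝ E'] [CompleteSpace E'] in
/-- **Uniform continuity in time of a continuous space–time field which is periodic in time and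
supported in a ball in space**: for every `ε > 0` there is `η ∈ (0, T/2]` with
`‖F(s − x, y) − F(s, y)‖ ≤ ε` for all `s, y` and `|x| ≤ η`. [folklore] -/
theorem exists_forall_norm_sub_le_of_periodic₂ (hT : 0 < T)
    {F : ℝ × EuclideanSpace ℝ (Fin 3) → E'} (hF : Continuous F)
    (hper : ∀ s (y : EuclideanSpace ℝ (Fin 3)), F (s + T, y) = F (s, y)) {R : ℝ}
    (hR : ∀ z : ℝ × EuclideanSpace ℝ (Fin 3), z.2 ∉ ball (0 : EuclideanSpace ℝ (Fin 3)) R → F z = 0)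
    {ε : ℝ} (hε : 0 < ε) :
    ∃ η : ℝ, 0 < η ∧ η ≤ T / 2 ∧ ∀ (s x : ℝ) (y : EuclideanSpace ℝ (Fin 3)), |x| ≤ η →
      ‖F (s - x, y) - F (s, y)‖ ≤ ε := by
  have hK : IsCompact (Icc (-T) (2 * T) ×ˢ closedBall (0 : EuclideanSpace ℝ (Fin 3)) R) :=
    isCompact_Icc.prod (isCompact_closedBall 0 R)
  have hU := hK.uniformContinuousOn_of_continuous hF.continuousOn
  rw [Metric.uniformContinuousOn_iff] at hU
  obtain ⟨η₀, hη₀, hη₀U⟩ := hU ε hε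
  refine ⟨min (η₀ / 2) (T / 2), lt_min (half_pos hη₀) (half_pos hT), min_le_right _ _,
    fun s x y hx => ?_⟩
  have hxη : |x| < η₀ := by
    have := hx.trans (min_le_left _ _); linarith
  have hxT : |x| ≤ T / 2 := hx.trans (min_le_right _ _)
  by_cases hy : y ∈ closedBall (0 : EuclideanSpace ℝ (Fin 3)) R
  · -- shift into one period
    have hp : Function.Periodic (fun t => F (t, y)) T := fun t => hper t y
    set n : ℤ := toIcoDiv hT 0 s with hn
    set s' : ℝ := s - n • T with hs'
    have hs'mem : s' ∈ Ico (0 : ℝ) (0 + T) := by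
      have h := toIcoMod_mem_Ico hT 0 s
      rwa [toIcoMod, ← hn] at h
    rw [zero_add] at hs'mem
    have e1 : F (s, y) = F (s', y) := by
      have := hp.sub_zsmul_eq n (x := s)
      exact this.symm
    have e2 : F (s - x, y) = F (s' - x, y) := by
      have := hp.sub_zsmul_eq n (x := s - x)
      have e : s - x - n • T = s' - x := by rw [hs']; ring
      rw [e] at this
      exact this.symm
    rw [e1, e2]
    have hmem1 : (s' - x, y) ∈ Icc (-T) (2 * T) ×ˢ closedBall (0 : EuclideanSpace ℝ (Fin 3)) R := by
      refine ⟨⟨?_, ?_⟩, hy⟩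
      · have := (abs_le.1 hxT).2; linarith [hs'mem.1]
      · have := (abs_le.1 hxT).1; linarith [hs'mem.2]
    have hmem2 : (s', y) ∈ Icc (-T) (2 * T) ×ˢ closedBall (0 : EuclideanSpace ℝ (Fin 3)) R :=
      ⟨⟨by linarith [hs'mem.1], by linarith [hs'mem.2]⟩, hy⟩
    have hdist : dist (s' - x, y) (s', y) < η₀ := by
      rw [Prod.dist_eq, dist_self, Real.dist_eq, show s' - x - s' = -x by ring, abs_neg]
      exact max_lt hxη (hη₀)
    have h := hη₀U _ hmem1 _ hmem2 hdist
    rw [dist_eq_norm] at h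
    exact h.le
  · have hy' : y ∉ ball (0 : EuclideanSpace ℝ (Fin 3)) R := fun h => hy (ball_subset_closedBall h)
    rw [hR (s - x, y) hy', hR (s, y) hy', sub_zero, norm_zero]
    exact hε.le

/-- **Riemann sums of `τ ↦ k(s − τ) Φ(τ, y)`**, uniformly in `(s, y)`: for a differentiable kernel
`k` with `|k| ≤ K₀`, `|k'| ≤ K₁` and a jointly smooth field `Φ` with `‖Φ‖ ≤ M`, `‖∂ₜΦ‖ ≤ M'`,
`‖Σ_{l<L} h k(s − lh) Φ(lh, y) − ∫₀ᵀ k(s − τ) Φ(τ, y) dτ‖ ≤ (K₁ M + K₀ M') T h`, `h = T/L`.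
[folklore] -/
theorem norm_riemannSum_kernel_sub_integral_le (hT : 0 < T) {k : ℝ → ℝ} (hk : Differentiable ℝ k)
    {K₀ K₁ : ℝ} (hK₀ : ∀ x, |k x| ≤ K₀) (hK₁ : ∀ x, |deriv k x| ≤ K₁)
    {Φ : ℝ → EuclideanSpace ℝ (Fin 3) → E'} (hΦ : ContDiff ℝ (⊤ : ℕ∞) (uncurry Φ))
    {M M' : ℝ} (hM : ∀ t y, ‖Φ t y‖ ≤ M) (hM' : ∀ t y, ‖timeDeriv Φ t y‖ ≤ M')
    {L : ℕ} (hL : 0 < L) (s : ℝ) (y : EuclideanSpace ℝ (Fin 3)) :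
    ‖(∑ l ∈ Finset.range L, (T / L) • (k (s - l * (T / L)) • Φ (l * (T / L)) y)) -
        ∫ τ in (0 : ℝ)..T, k (s - τ) • Φ τ y‖ ≤ (K₁ * M + K₀ * M') * T * (T / L) := by
  set φ : ℝ → E' := fun τ => k (s - τ) • Φ τ y with hφdef
  have hderiv : ∀ τ, HasDerivAt φ (k (s - τ) • timeDeriv Φ τ y + (-deriv k (s - τ)) • Φ τ y) τ := by
    intro τ
    have h1 : HasDerivAt (fun τ => k (s - τ)) (-deriv k (s - τ)) τ :=
      HasDerivAt.comp_const_sub s τ (hk (s - τ)).hasDerivAt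
    exact h1.smul (hasDerivAt_timeLine_of_contDiff hΦ τ y)
  have hφd : Differentiable ℝ φ := fun τ => (hderiv τ).differentiableAt
  have hM0 : 0 ≤ M := (norm_nonneg _).trans (hM 0 0)
  have hM'0 : 0 ≤ M' := (norm_nonneg _).trans (hM' 0 0)
  have hK00 : 0 ≤ K₀ := (abs_nonneg _).trans (hK₀ 0)
  have hK10 : 0 ≤ K₁ := (abs_nonneg _).trans (hK₁ 0)
  have hbound : ∀ τ, ‖deriv φ τ‖ ≤ K₁ * M + K₀ * M' := by
    intro τ
    rw [(hderiv τ).deriv]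
    calc ‖k (s - τ) • timeDeriv Φ τ y + (-deriv k (s - τ)) • Φ τ y‖
        ≤ ‖k (s - τ) • timeDeriv Φ τ y‖ + ‖(-deriv k (s - τ)) • Φ τ y‖ := norm_add_le _ _
      _ = |k (s - τ)| * ‖timeDeriv Φ τ y‖ + |deriv k (s - τ)| * ‖Φ τ y‖ := by
          rw [norm_smul, norm_smul, Real.norm_eq_abs, Real.norm_eq_abs, abs_neg]
      _ ≤ K₀ * M' + K₁ * M := add_le_add (mul_le_mul (hK₀ _) (hM' _ _) (norm_nonneg _) hK00)
          (mul_le_mul (hK₁ _) (hM _ _) (norm_nonneg _) hK10)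
      _ = K₁ * M + K₀ * M' := by ring
  have h := norm_riemannSum_sub_integral_le hφd hbound hT hL
  simpa only [hφdef] using h

/-- **Integration by parts over a period**: for a differentiable `T`-periodic kernel `k` with
continuous derivative and a jointly smooth field `Φ` periodic in time,
`∫₀ᵀ k'(s − τ) Φ(τ, y) dτ = ∫₀ᵀ k(s − τ) ∂ₜΦ(τ, y) dτ`. [folklore] -/
theorem integral_deriv_kernel_smul_eq {k : ℝ → ℝ} (hk : ContDiff ℝ 1 k)
    (hkper : Function.Periodic k T)
    {Φ : ℝ → EuclideanSpace ℝ (Fin 3) → E'} (hΦ : ContDiff ℝ (⊤ : ℕ∞) (uncurry Φ))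
    (hΦper : ∀ t y, Φ (t + T) y = Φ t y) (s : ℝ) (y : EuclideanSpace ℝ (Fin 3)) :
    ∫ τ in (0 : ℝ)..T, deriv k (s - τ) • Φ τ y = ∫ τ in (0 : ℝ)..T, k (s - τ) • timeDeriv Φ τ y := by
  have hkd : Differentiable ℝ k := hk.differentiable one_ne_zero
  have hk'c : Continuous (deriv k) := hk.continuous_deriv le_rfl
  set φ : ℝ → E' := fun τ => k (s - τ) • Φ τ y with hφdef
  have hderiv : ∀ τ, HasDerivAt φ (k (s - τ) • timeDeriv Φ τ y + (-deriv k (s - τ)) • Φ τ y) τ := by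
    intro τ
    have h1 : HasDerivAt (fun τ => k (s - τ)) (-deriv k (s - τ)) τ :=
      HasDerivAt.comp_const_sub s τ (hkd (s - τ)).hasDerivAt
    exact h1.smul (hasDerivAt_timeLine_of_contDiff hΦ τ y)
  -- continuity of the pieces
  have cΦ : Continuous fun τ => Φ τ y :=
    hΦ.continuous.comp (continuous_id.prodMk continuous_const)
  have cΦt : Continuous fun τ => timeDeriv Φ τ y :=
    (contDiff_uncurry_timeDeriv hΦ).continuous.comp (continuous_id.prodMk continuous_const)
  have ck : Continuous fun τ => k (s - τ) := hk.continuous.comp (continuous_const.sub continuous_id)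
  have ck' : Continuous fun τ => deriv k (s - τ) := hk'c.comp (continuous_const.sub continuous_id)
  have i1 : IntervalIntegrable (fun τ => k (s - τ) • timeDeriv Φ τ y) volume 0 T :=
    (ck.smul cΦt).intervalIntegrable _ _
  have i2 : IntervalIntegrable (fun τ => (-deriv k (s - τ)) • Φ τ y) volume 0 T :=
    (ck'.neg.smul cΦ).intervalIntegrable _ _
  have hFTC := intervalIntegral.integral_eq_sub_of_hasDerivAt (fun τ _ => hderiv τ) (i1.add i2)
  have hper0 : φ T = φ 0 := by
    simp only [hφdef]
    have e1 : Φ T y = Φ 0 y := by have := hΦper 0 y; rwa [zero_add] at this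
    have e2 : k (s - T) = k (s - 0) := by
      rw [sub_zero]; have := hkper (s - T); rw [sub_add_cancel] at this; exact this.symm
    rw [e1, e2]
  rw [hper0, sub_self, intervalIntegral.integral_add i1 i2] at hFTC
  have e3 : ∫ τ in (0 : ℝ)..T, (-deriv k (s - τ)) • Φ τ y = -∫ τ in (0 : ℝ)..T, deriv k (s - τ) • Φ τ y := by
    rw [← intervalIntegral.integral_neg]
    congr 1; funext τ; rw [neg_smul]
  rw [e3] at hFTC
  -- `A + (-B) = 0`
  have : (∫ τ in (0 : ℝ)..T, k (s - τ) • timeDeriv Φ τ y) - ∫ τ in (0 : ℝ)..T, deriv k (s - τ) • Φ τ y = 0 := by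
    rw [sub_eq_add_neg]; exact hFTC
  exact (sub_eq_zero.1 this).symm

end Fields

/-! ### The approximation of `𝒟_T` by test fields with values in the Galerkin spaces -/

/-- `‖a − d‖ ≤ ‖a − b‖ + ‖b − c‖ + ‖c − d‖`. [folklore] -/
theorem norm_sub_le_of_le_three {X : Type*} [NormedAddCommGroup X] (a b c d : X) :
    ‖a - d‖ ≤ ‖a - b‖ + ‖b - c‖ + ‖c - d‖ := by
  linarith [norm_sub_le_norm_sub_add_norm_sub a c d, norm_sub_le_norm_sub_add_norm_sub a b c]

/-- The derivative of a periodic map is periodic (`deriv` commutes with translations). [folklore] -/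
theorem periodic_deriv_of_periodic {X : Type*} [NormedAddCommGroup X] [NormedSpace ℝ X]
    {γ : ℝ → X} {c : ℝ} (h : Function.Periodic γ c) : Function.Periodic (deriv γ) c := by
  intro s
  have hfun : (fun x => γ (x + c)) = γ := funext h
  rw [← deriv_comp_add_const γ c s, hfun]

section Main

variable {E' : Type*} [NormedAddCommGroup E'] [NormedSpace ℝ E'] [CompleteSpace E'] {T : ℝ} {n : ℕ}

omit [CompleteSpace E'] in
/-- The periodic convolution with the normalised kernel in centred form. [folklore] -/
theorem integral_cosKernel_div_comp_sub_smul_eq (hT : 0 < T) {u : ℝ → E'}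
    (hper : Function.Periodic u T) (Z s : ℝ) :
    ∫ τ in (0 : ℝ)..T, ((1 + Real.cos (2 * π * (s - τ) / T)) ^ n / Z) • u τ =
      ∫ x in (-(T / 2))..(T / 2), ((1 + Real.cos (2 * π * x / T)) ^ n / Z) • u (s - x) := by
  have h := integral_cosKernel_comp_sub_smul_eq (n := n) hT hper (1 / Z) s
  have e : ∀ x : ℝ, 1 / Z * (1 + Real.cos (2 * π * x / T)) ^ n = (1 + Real.cos (2 * π * x / T)) ^ n / Z :=
    fun x => by ring
  simp only [e] at h
  exact h

set_option maxHeartbeats 1600000 in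
/-- **Every `f ∈ 𝒟_T` is approximated, uniformly with `∂ₛf` and `D_y f` and with supports in a
common ball independent of the accuracy, by `T`-periodic divergence-free test fields with values
in a Galerkin space** (the radius first, then the accuracy). Let
`σ : ℕ → 𝒱` be `C¹`-dense with controlled supports (`exists_countable_dense_testDivFree`) and
`V_m = span{σ₀,…,σ_m}`. Then for every `f ∈ 𝒟_T` and `δ > 0` there are `m` and `g ∈ 𝒟_T` with
`g(s) ∈ V_m` for every `s`, a common radius `R` beyond which `f` and `g` vanish, and
`|f − g|, |D_y f − D_y g|, |∂ₛf − ∂ₛg| ≤ δ` everywhere. Construction: `g(s) = Σ_l h k_n(s − lh) σ_{n_l}`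
with the kernel `k_n` of this file, `h = T/L`, and `σ_{n_l}` `C¹`-close to `f(lh)`; see the module
docstring (Temam, Ch. III §3, the density argument after (3.52), made quantitative and
constructive). [cite: Temam1979, Ch. III §3 (3.50)–(3.52) and the density argument; BradshawTsai2017AHP, proof of Thm 2.4 ("holds for all f ∈ 𝒟_T")] -/
theorem exists_galerkin_test_approx_uniform (hT : 0 < T)
    {σ : ℕ → EuclideanSpace ℝ (Fin 3) → EuclideanSpace ℝ (Fin 3)} (hσ : ∀ n, σ n ∈ testDivFreeSubmodule)
    (hσd : ∀ (N : ℕ) (ζ : EuclideanSpace ℝ (Fin 3) → EuclideanSpace ℝ (Fin 3)),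
      ζ ∈ testDivFreeSubmodule → tsupport ζ ⊆ closedBall (0 : EuclideanSpace ℝ (Fin 3)) N →
        ∀ δ : ℝ, 0 < δ → ∃ n, tsupport (σ n) ⊆ closedBall (0 : EuclideanSpace ℝ (Fin 3)) N ∧
          ∀ y, ‖ζ y - σ n y‖ ≤ δ ∧ ‖fderiv ℝ ζ y - fderiv ℝ (σ n) y‖ ≤ δ)
    {f : ℝ → EuclideanSpace ℝ (Fin 3) → EuclideanSpace ℝ (Fin 3)} (hf : IsPeriodicDivFreeTest T f) :
    ∃ R : ℝ, (∀ s y, R ≤ ‖y‖ → f s y = 0) ∧ ∀ δ : ℝ, 0 < δ →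
      ∃ (m : ℕ) (g : ℝ → EuclideanSpace ℝ (Fin 3) → EuclideanSpace ℝ (Fin 3)),
        IsPeriodicDivFreeTest T g ∧ (∀ s, g s ∈ galerkinSpace σ m) ∧
        (∀ s y, R ≤ ‖y‖ → g s y = 0) ∧
        ∀ s y, ‖f s y - g s y‖ ≤ δ ∧ ‖fderiv ℝ (f s) y - fderiv ℝ (g s) y‖ ≤ δ ∧
          ‖timeDeriv f s y - timeDeriv g s y‖ ≤ δ := by
  -- ## (0) the test field, its support, its slices
  have hfs : ContDiff ℝ (⊤ : ℕ∞) (uncurry f) := hf.contDiff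
  obtain ⟨Rf, hRf⟩ := hf.compact_support
  set R₁ : ℝ := |Rf| + 1 with hR₁
  have hR₁f : ∀ s y, R₁ ≤ ‖y‖ → f s y = 0 := fun s y hy =>
    hRf s y ((le_abs_self Rf).trans (by linarith))
  have htsupp : ∀ s, tsupport (f s) ⊆ closedBall (0 : EuclideanSpace ℝ (Fin 3)) |Rf| := by
    intro s
    refine closure_minimal (fun y hy => ?_) isClosed_closedBall
    rw [mem_closedBall_zero_iff]
    by_contra h
    exact hy (hRf s y ((le_abs_self Rf).trans (not_le.1 h).le))
  obtain ⟨N, hN⟩ := exists_nat_ge |Rf|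
  have htsuppN : ∀ s, tsupport (f s) ⊆ closedBall (0 : EuclideanSpace ℝ (Fin 3)) N :=
    fun s => (htsupp s).trans (closedBall_subset_closedBall hN)
  have hslice : ∀ s, ContDiff ℝ (⊤ : ℕ∞) (f s) := fun s => contDiff_slice_of_contDiff_uncurry hfs s
  have hcs : ∀ s, HasCompactSupport (f s) := fun s =>
    HasCompactSupport.of_support_subset_isCompact (isCompact_closedBall 0 |Rf|)
      ((subset_tsupport _).trans (htsupp s))
  have hfmem : ∀ s, f s ∈ testDivFreeSubmodule := fun s =>
    ⟨⟨hslice s, hcs s, by simp⟩, hf.divFree s⟩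
  have hper : ∀ s y, f (s + T) y = f s y := hf.periodic
  have hperF : ∀ s, f (s + T) = f s := fun s => funext (hper s)
  -- ## (1) the derivative fields
  set Φ₁ : ℝ → EuclideanSpace ℝ (Fin 3) → (EuclideanSpace ℝ (Fin 3) →L[ℝ] EuclideanSpace ℝ (Fin 3)) :=
    fun s y => fderiv ℝ (f s) y with hΦ₁
  set Φ₂ : ℝ → EuclideanSpace ℝ (Fin 3) → EuclideanSpace ℝ (Fin 3) := timeDeriv f with hΦ₂
  have hΦ₁s : ContDiff ℝ (⊤ : ℕ∞) (uncurry Φ₁) := contDiff_uncurry_fderiv_slice hfs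
  have hΦ₂s : ContDiff ℝ (⊤ : ℕ∞) (uncurry Φ₂) := contDiff_uncurry_timeDeriv hfs
  -- periodicity of a time derivative and vanishing off the ball: generic helpers
  have tper : ∀ {X : Type} [NormedAddCommGroup X] [NormedSpace ℝ X]
      (Φ : ℝ → EuclideanSpace ℝ (Fin 3) → X), (∀ s y, Φ (s + T) y = Φ s y) →
      ∀ s y, timeDeriv Φ (s + T) y = timeDeriv Φ s y := by
    intro X _ _ Φ hΦ s y
    have hp : Function.Periodic (fun t => Φ t y) T := fun t => hΦ t y
    simp only [timeDeriv]
    exact periodic_deriv_of_periodic hp s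
  have tvan : ∀ {X : Type} [NormedAddCommGroup X] [NormedSpace ℝ X]
      (Φ : ℝ → EuclideanSpace ℝ (Fin 3) → X), (∀ s y, R₁ ≤ ‖y‖ → Φ s y = 0) →
      ∀ s y, R₁ ≤ ‖y‖ → timeDeriv Φ s y = 0 := by
    intro X _ _ Φ hΦ s y hy
    have h0 : (fun t => Φ t y) = fun _ => (0 : X) := funext fun t => hΦ t y hy
    simp only [timeDeriv, h0, deriv_const]
  have hΦ₁per : ∀ s y, Φ₁ (s + T) y = Φ₁ s y := fun s y => by simp only [hΦ₁, hperF s]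
  have hΦ₂per : ∀ s y, Φ₂ (s + T) y = Φ₂ s y := tper f hper
  have hΦ₁van : ∀ s y, R₁ ≤ ‖y‖ → Φ₁ s y = 0 := by
    intro s y hy
    simp only [hΦ₁]
    refine fderiv_of_notMem_tsupport ℝ fun h => ?_
    have := mem_closedBall_zero_iff.1 (htsupp s h)
    linarith
  have hΦ₂van : ∀ s y, R₁ ≤ ‖y‖ → Φ₂ s y = 0 := tvan f hR₁f
  -- ## (2) bounds and uniform continuity in time
  have gb : ∀ {X : Type} [NormedAddCommGroup X] (Φ : ℝ → EuclideanSpace ℝ (Fin 3) → X),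
      Continuous (uncurry Φ) → (∀ s y, Φ (s + T) y = Φ s y) → (∀ s y, R₁ ≤ ‖y‖ → Φ s y = 0) →
      ∃ C : ℝ, 0 ≤ C ∧ ∀ s y, ‖Φ s y‖ ≤ C := by
    intro X _ Φ hc hp hv
    obtain ⟨C, hC0, hC⟩ := exists_global_bound_of_periodic (F := uncurry Φ) hc hT
      (fun s y => hp s y) (R := R₁) fun z hz => hv z.1 z.2 (by
        rw [mem_ball_zero_iff, not_lt] at hz; exact hz)
    exact ⟨C, hC0, fun s y => hC (s, y)⟩
  obtain ⟨M₀, hM₀0, hM₀⟩ := gb f hfs.continuous hper hR₁f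
  obtain ⟨M₁, hM₁0, hM₁⟩ := gb Φ₁ hΦ₁s.continuous hΦ₁per hΦ₁van
  obtain ⟨M₂, hM₂0, hM₂⟩ := gb Φ₂ hΦ₂s.continuous hΦ₂per hΦ₂van
  obtain ⟨M₃, hM₃0, hM₃⟩ := gb (timeDeriv Φ₁) (contDiff_uncurry_timeDeriv hΦ₁s).continuous
    (tper Φ₁ hΦ₁per) (tvan Φ₁ hΦ₁van)
  obtain ⟨M₄, hM₄0, hM₄⟩ := gb (timeDeriv Φ₂) (contDiff_uncurry_timeDeriv hΦ₂s).continuous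
    (tper Φ₂ hΦ₂per) (tvan Φ₂ hΦ₂van)
  set M : ℝ := M₀ + M₁ + M₂ + M₃ + M₄ + 1 with hM
  have hMpos : 0 < M := by positivity
  have bM₀ : ∀ s y, ‖f s y‖ ≤ M := fun s y => (hM₀ s y).trans (by linarith)
  have bM₁ : ∀ s y, ‖Φ₁ s y‖ ≤ M := fun s y => (hM₁ s y).trans (by linarith)
  have bM₂ : ∀ s y, ‖Φ₂ s y‖ ≤ M := fun s y => (hM₂ s y).trans (by linarith)
  have bM₃ : ∀ s y, ‖timeDeriv Φ₁ s y‖ ≤ M := fun s y => (hM₃ s y).trans (by linarith)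
  have bM₄ : ∀ s y, ‖timeDeriv Φ₂ s y‖ ≤ M := fun s y => (hM₄ s y).trans (by linarith)
  -- ## the radius, then `δ`
  refine ⟨max R₁ (N + 1), fun s y hy => hR₁f s y ((le_max_left _ _).trans hy), fun δ hδ => ?_⟩
  -- uniform continuity with `ε = δ/4`
  have hε : 0 < δ / 4 := by positivity
  have uc : ∀ {X : Type} [NormedAddCommGroup X] (Φ : ℝ → EuclideanSpace ℝ (Fin 3) → X),
      Continuous (uncurry Φ) → (∀ s y, Φ (s + T) y = Φ s y) → (∀ s y, R₁ ≤ ‖y‖ → Φ s y = 0) →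
      ∃ η : ℝ, 0 < η ∧ η ≤ T / 2 ∧ ∀ (s x : ℝ) (y : EuclideanSpace ℝ (Fin 3)), |x| ≤ η →
        ‖Φ (s - x) y - Φ s y‖ ≤ δ / 4 := by
    intro X _ Φ hc hp hv
    obtain ⟨η, hη, hηT, h⟩ := exists_forall_norm_sub_le_of_periodic₂ (F := uncurry Φ) hT hc
      (fun s y => hp s y) (R := R₁) (fun z hz => hv z.1 z.2 (by
        rw [mem_ball_zero_iff, not_lt] at hz; exact hz)) hε
    exact ⟨η, hη, hηT, fun s x y hx => h s x y hx⟩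
  obtain ⟨η₀, hη₀, hη₀T, huc₀⟩ := uc f hfs.continuous hper hR₁f
  obtain ⟨η₁, hη₁, -, huc₁⟩ := uc Φ₁ hΦ₁s.continuous hΦ₁per hΦ₁van
  obtain ⟨η₂, hη₂, -, huc₂⟩ := uc Φ₂ hΦ₂s.continuous hΦ₂per hΦ₂van
  set η : ℝ := min η₀ (min η₁ η₂) with hηdef
  have hη : 0 < η := lt_min hη₀ (lt_min hη₁ hη₂)
  have hηT : η ≤ T / 2 := (min_le_left _ _).trans hη₀T
  have hηle₀ : η ≤ η₀ := min_le_left _ _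
  have hηle₁ : η ≤ η₁ := (min_le_right _ _).trans (min_le_left _ _)
  have hηle₂ : η ≤ η₂ := (min_le_right _ _).trans (min_le_right _ _)
  -- ## (3) the exponent `n`: the tail `2 M T rⁿ/η ≤ δ/4`
  set r : ℝ := (1 + Real.cos (2 * π * η / T)) / (1 + Real.cos (π * η / T)) with hr
  have hr0 : 0 ≤ r := cosRatio_nonneg T η
  have hr1 : r < 1 := cosRatio_lt_one hT hη hηT
  obtain ⟨n, hn⟩ := exists_pow_lt_of_lt_one (show 0 < δ / 4 * η / (2 * M * T + 1) by positivity) hr1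
  have htail : 2 * M * T * (r ^ n / η) ≤ δ / 4 := by
    have h1 : r ^ n ≤ δ / 4 * η / (2 * M * T + 1) := hn.le
    have h2 : 2 * M * T * (r ^ n / η) ≤ (2 * M * T + 1) * (r ^ n / η) := by
      gcongr; linarith
    refine h2.trans ?_
    rw [mul_div_assoc']
    rw [div_le_iff₀ hη]
    calc (2 * M * T + 1) * r ^ n ≤ (2 * M * T + 1) * (δ / 4 * η / (2 * M * T + 1)) := by gcongr
      _ = δ / 4 * η := by field_simp
  -- ## (4) the kernel `k = (1 + cos(2π·/T))ⁿ / Z` and its bounds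
  set Z : ℝ := ∫ x in (-(T / 2))..(T / 2), (1 + Real.cos (2 * π * x / T)) ^ n with hZ
  have hZpos : 0 < Z := cosPow_integral_pos hT n
  set k : ℝ → ℝ := fun x => (1 + Real.cos (2 * π * x / T)) ^ n / Z with hk
  have hks : ContDiff ℝ (⊤ : ℕ∞) k := (contDiff_cosPow T n).div_const Z
  have hkd : Differentiable ℝ k := hks.differentiable (by simp)
  have hkper : Function.Periodic k T := fun x => by
    have h := cosPow_periodic hT.ne' n x
    simp only at h
    simp only [hk, h]
  have hk1 : ContDiff ℝ 1 k := hks.of_le (by exact_mod_cast le_top)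
  have hk1s : ContDiff ℝ (⊤ : ℕ∞) (deriv k) := by simpa using ContDiff.iterate_deriv 1 hks
  have hk2s : ContDiff ℝ (⊤ : ℕ∞) (deriv (deriv k)) := by
    simpa [Function.iterate_succ] using ContDiff.iterate_deriv 2 hks
  have hk'd : Differentiable ℝ (deriv k) := hk1s.differentiable (by simp)
  have hk'per : Function.Periodic (deriv k) T := periodic_deriv_of_periodic hkper
  have hk''per : Function.Periodic (deriv (deriv k)) T := periodic_deriv_of_periodic hk'per
  obtain ⟨K₀, hK₀0, hK₀⟩ := exists_bound_of_continuous_periodic hks.continuous hT hkper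
  obtain ⟨K₁, hK₁0, hK₁⟩ := exists_bound_of_continuous_periodic hk1s.continuous hT hk'per
  obtain ⟨K₂, hK₂0, hK₂⟩ := exists_bound_of_continuous_periodic hk2s.continuous hT hk''per
  -- ## (5) the number of nodes `L` and the tolerance `δ'`
  set A : ℝ := ((K₁ + K₀) + (K₂ + K₁)) * M * T * T with hA
  have hA0 : 0 ≤ A := by positivity
  obtain ⟨L, hL⟩ := exists_nat_gt (4 * A / δ)
  have hLpos : 0 < L := Nat.cast_pos.1 ((by positivity : (0:ℝ) ≤ 4 * A / δ).trans_lt hL)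
  have hL' : (0 : ℝ) < L := Nat.cast_pos.2 hLpos
  have hAL : A / L ≤ δ / 4 := by
    rw [div_le_iff₀ hL']
    have := (div_lt_iff₀ hδ).1 hL
    linarith
  have hRiem₀ : (K₁ * M + K₀ * M) * T * (T / L) ≤ δ / 4 := by
    refine le_trans ?_ hAL
    rw [le_div_iff₀ hL']
    have e : (K₁ * M + K₀ * M) * T * (T / L) * L = (K₁ + K₀) * M * T * T := by field_simp
    rw [e, hA]
    have hx : ((K₁ + K₀) + (K₂ + K₁)) * M * T * T =
        (K₁ + K₀) * M * T * T + (K₂ + K₁) * M * T * T := by ring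
    rw [hx]
    linarith [mul_nonneg (mul_nonneg (mul_nonneg (add_nonneg hK₂0 hK₁0) hMpos.le) hT.le) hT.le]
  have hRiem₁ : (K₂ * M + K₁ * M) * T * (T / L) ≤ δ / 4 := by
    refine le_trans ?_ hAL
    rw [le_div_iff₀ hL']
    have e : (K₂ * M + K₁ * M) * T * (T / L) * L = (K₂ + K₁) * M * T * T := by field_simp
    rw [e, hA]
    have hx : ((K₁ + K₀) + (K₂ + K₁)) * M * T * T =
        (K₁ + K₀) * M * T * T + (K₂ + K₁) * M * T * T := by ring
    rw [hx]
    linarith [mul_nonneg (mul_nonneg (mul_nonneg (add_nonneg hK₁0 hK₀0) hMpos.le) hT.le) hT.le]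
  set h : ℝ := T / L with hh
  have hh0 : 0 < h := div_pos hT hL'
  have hLh : (L : ℝ) * h = T := by rw [hh]; field_simp
  set δ' : ℝ := δ / (4 * (T * K₀ + T * K₁ + 1)) with hδ'
  have hδ'0 : 0 < δ' := by positivity
  have hden : 0 < T * K₀ + T * K₁ + 1 := by positivity
  have hδ'K₀ : T * K₀ * δ' ≤ δ / 4 := by
    have h1 : T * K₀ / (T * K₀ + T * K₁ + 1) ≤ 1 :=
      (div_le_one hden).2 (by linarith [mul_nonneg hT.le hK₁0])
    have e : T * K₀ * δ' = T * K₀ / (T * K₀ + T * K₁ + 1) * (δ / 4) := by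
      rw [hδ']; field_simp
    rw [e]
    calc T * K₀ / (T * K₀ + T * K₁ + 1) * (δ / 4) ≤ 1 * (δ / 4) :=
        mul_le_mul_of_nonneg_right h1 hε.le
      _ = δ / 4 := one_mul _
  have hδ'K₁ : T * K₁ * δ' ≤ δ / 4 := by
    have h1 : T * K₁ / (T * K₀ + T * K₁ + 1) ≤ 1 :=
      (div_le_one hden).2 (by linarith [mul_nonneg hT.le hK₀0])
    have e : T * K₁ * δ' = T * K₁ / (T * K₀ + T * K₁ + 1) * (δ / 4) := by
      rw [hδ']; field_simp
    rw [e]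
    calc T * K₁ / (T * K₀ + T * K₁ + 1) * (δ / 4) ≤ 1 * (δ / 4) :=
        mul_le_mul_of_nonneg_right h1 hε.le
      _ = δ / 4 := one_mul _
  -- ## (6) the node fields and the approximating field
  choose nn hnnsupp hnn using fun l : ℕ => hσd N (f (l * h)) (hfmem _) (htsuppN _) δ' hδ'0
  set m : ℕ := (Finset.range L).sup nn with hm
  have hnnle : ∀ l ∈ Finset.range L, nn l ≤ m := fun l hl => Finset.le_sup hl
  have hσtest : ∀ l, FunctionSpaces.IsTestFunctionOn (⊤ : Opens (EuclideanSpace ℝ (Fin 3))) (σ (nn l)) :=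
    fun l => (hσ (nn l)).1
  have hσ0 : ∀ l y, (N : ℝ) + 1 ≤ ‖y‖ → σ (nn l) y = 0 := by
    intro l y hy
    refine image_eq_zero_of_notMem_tsupport fun h' => ?_
    have := mem_closedBall_zero_iff.1 (hnnsupp l h')
    linarith
  refine ⟨m, fun s y => ∑ l ∈ Finset.range L, (h * k (s - l * h)) • σ (nn l) y, ?_, ?_, ?_, ?_⟩
  · -- ### `g ∈ 𝒟_T`
    have hmem : ∀ s, (fun y => ∑ l ∈ Finset.range L, (h * k (s - l * h)) • σ (nn l) y) ∈ galerkinSpace σ m := by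
      intro s
      have e : (fun y => ∑ l ∈ Finset.range L, (h * k (s - l * h)) • σ (nn l) y) =
          ∑ l ∈ Finset.range L, (h * k (s - l * h)) • σ (nn l) := by
        funext y; simp only [Finset.sum_apply, Pi.smul_apply]
      rw [e]
      exact Submodule.sum_mem _ fun l hl => Submodule.smul_mem _ _ (mem_galerkinSpace (hnnle l hl))
    refine ⟨?_, ?_, ?_, ?_⟩
    · show ContDiff ℝ (⊤ : ℕ∞) fun z : ℝ × EuclideanSpace ℝ (Fin 3) =>
        ∑ l ∈ Finset.range L, (h * k (z.1 - l * h)) • σ (nn l) z.2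
      exact ContDiff.sum fun l _ => (contDiff_const.mul (hks.comp (contDiff_fst.sub contDiff_const))).smul
        ((hσtest l).contDiff.comp contDiff_snd)
    · intro s y
      refine Finset.sum_congr rfl fun l _ => ?_
      rw [show s + T - l * h = s - l * h + T by ring, hkper]
    · intro s
      exact (galerkinSpace_le hσ m (hmem s)).2
    · refine ⟨N + 1, fun s y hy => Finset.sum_eq_zero fun l _ => ?_⟩
      rw [hσ0 l y hy, smul_zero]
  · -- ### `g(s) ∈ V_m`
    intro s
    have e : (fun y => ∑ l ∈ Finset.range L, (h * k (s - l * h)) • σ (nn l) y) =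
        ∑ l ∈ Finset.range L, (h * k (s - l * h)) • σ (nn l) := by
      funext y; simp only [Finset.sum_apply, Pi.smul_apply]
    show (fun y => ∑ l ∈ Finset.range L, (h * k (s - l * h)) • σ (nn l) y) ∈ galerkinSpace σ m
    rw [e]
    exact Submodule.sum_mem _ fun l hl => Submodule.smul_mem _ _ (mem_galerkinSpace (hnnle l hl))
  · -- ### common support radius
    intro s y hy
    exact Finset.sum_eq_zero fun l _ => by rw [hσ0 l y ((le_max_right _ _).trans hy), smul_zero]
  · -- ### the three estimates
    intro s y
    -- the approximate identity for the three fields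
    have AI : ∀ {X : Type} [NormedAddCommGroup X] [NormedSpace ℝ X] [CompleteSpace X]
        (Φ : ℝ → EuclideanSpace ℝ (Fin 3) → X), Continuous (uncurry Φ) →
        (∀ s y, Φ (s + T) y = Φ s y) → (∀ s y, ‖Φ s y‖ ≤ M) →
        (∀ (s x : ℝ) (y : EuclideanSpace ℝ (Fin 3)), |x| ≤ η → ‖Φ (s - x) y - Φ s y‖ ≤ δ / 4) →
        ‖(∫ τ in (0 : ℝ)..T, k (s - τ) • Φ τ y) - Φ s y‖ ≤ δ / 2 := by
      intro X _ _ _ Φ hc hp hb hu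
      have hpu : Function.Periodic (fun t => Φ t y) T := fun t => hp t y
      have hcu : Continuous fun t => Φ t y := hc.comp (continuous_id.prodMk continuous_const)
      have e := integral_cosKernel_div_comp_sub_smul_eq (n := n) hT hpu Z s
      have h1 := norm_integral_cosKernel_smul_sub_le (n := n) hT hcu (fun t => hb t y) hη hηT hε.le s
        (fun x hx => hu s x y hx)
      simp only [hk]
      rw [e]
      refine h1.trans ?_
      linarith [htail]
    -- the Riemann sums
    have RS : ∀ {X : Type} [NormedAddCommGroup X] [NormedSpace ℝ X] [CompleteSpace X]
        {κ : ℝ → ℝ}, Differentiable ℝ κ → ∀ {B₀ B₁ : ℝ}, (∀ x, |κ x| ≤ B₀) → (∀ x, |deriv κ x| ≤ B₁) →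
        ∀ (Φ : ℝ → EuclideanSpace ℝ (Fin 3) → X), ContDiff ℝ (⊤ : ℕ∞) (uncurry Φ) →
        (∀ s y, ‖Φ s y‖ ≤ M) → (∀ s y, ‖timeDeriv Φ s y‖ ≤ M) →
        ‖(∑ l ∈ Finset.range L, h • (κ (s - l * h) • Φ (l * h) y)) -
            ∫ τ in (0 : ℝ)..T, κ (s - τ) • Φ τ y‖ ≤ (B₁ * M + B₀ * M) * T * (T / L) := by
      intro X _ _ _ κ hκ B₀ B₁ hB₀ hB₁ Φ hΦ hb hb'
      exact norm_riemannSum_kernel_sub_integral_le hT hκ hB₀ hB₁ hΦ hb hb' hLpos s y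
    -- the node replacement
    have ND : ∀ {X : Type} [NormedAddCommGroup X] [NormedSpace ℝ X] (κ : ℝ → ℝ) {B : ℝ},
        (∀ x, |κ x| ≤ B) → ∀ (a b : ℕ → X), (∀ l, ‖a l - b l‖ ≤ δ') →
        ‖(∑ l ∈ Finset.range L, h • (κ (s - l * h) • a l)) -
            ∑ l ∈ Finset.range L, (h * κ (s - l * h)) • b l‖ ≤ T * B * δ' := by
      intro X _ _ κ B hB a b hab
      have hB0 : 0 ≤ B := (abs_nonneg _).trans (hB 0)
      rw [← Finset.sum_sub_distrib]
      calc ‖∑ l ∈ Finset.range L, (h • (κ (s - l * h) • a l) - (h * κ (s - l * h)) • b l)‖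
          ≤ ∑ l ∈ Finset.range L, ‖h • (κ (s - l * h) • a l) - (h * κ (s - l * h)) • b l‖ :=
            norm_sum_le _ _
        _ ≤ ∑ _l ∈ Finset.range L, h * B * δ' := by
            refine Finset.sum_le_sum fun l _ => ?_
            rw [smul_smul, ← smul_sub, norm_smul, Real.norm_eq_abs, abs_mul, abs_of_pos hh0]
            exact mul_le_mul (mul_le_mul_of_nonneg_left (hB _) hh0.le) (hab l) (norm_nonneg _)
              (by positivity)
        _ = T * B * δ' := by
            rw [Finset.sum_const, Finset.card_range, nsmul_eq_mul]
            calc (L : ℝ) * (h * B * δ') = (L * h) * B * δ' := by ring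
              _ = T * B * δ' := by rw [hLh]
    refine ⟨?_, ?_, ?_⟩
    · -- #### values
      have h1 := AI f hfs.continuous hper bM₀ (fun s x y hx => huc₀ s x y (hx.trans hηle₀))
      have h2 := RS hkd hK₀ hK₁ f hfs bM₀ bM₂
      have h3 := ND k hK₀ (fun l => f (l * h) y) (fun l => σ (nn l) y) (fun l => (hnn l y).1)
      calc ‖f s y - ∑ l ∈ Finset.range L, (h * k (s - l * h)) • σ (nn l) y‖
          ≤ ‖f s y - ∫ τ in (0 : ℝ)..T, k (s - τ) • f τ y‖ +
              ‖(∫ τ in (0 : ℝ)..T, k (s - τ) • f τ y) -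
                ∑ l ∈ Finset.range L, h • (k (s - l * h) • f (l * h) y)‖ +
              ‖(∑ l ∈ Finset.range L, h • (k (s - l * h) • f (l * h) y)) -
                ∑ l ∈ Finset.range L, (h * k (s - l * h)) • σ (nn l) y‖ := norm_sub_le_of_le_three _ _ _ _
        _ ≤ δ / 2 + δ / 4 + δ / 4 := by
            refine add_le_add (add_le_add ?_ ?_) ?_
            · rw [norm_sub_rev]; exact h1
            · rw [norm_sub_rev]; exact h2.trans hRiem₀
            · exact h3.trans hδ'K₀
        _ = δ := by ring
    · -- #### space derivatives
      have hD : fderiv ℝ (fun y => ∑ l ∈ Finset.range L, (h * k (s - l * h)) • σ (nn l) y) y =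
          ∑ l ∈ Finset.range L, (h * k (s - l * h)) • fderiv ℝ (σ (nn l)) y := by
        have hdl : ∀ l ∈ Finset.range L, HasFDerivAt ((h * k (s - l * h)) • σ (nn l))
            ((h * k (s - l * h)) • fderiv ℝ (σ (nn l)) y) y := fun l _ =>
          (((hσtest l).contDiff.differentiable (by simp)) y).hasFDerivAt.const_smul (h * k (s - l * h))
        have e : (fun y => ∑ l ∈ Finset.range L, (h * k (s - l * h)) • σ (nn l) y) =
            ∑ l ∈ Finset.range L, (h * k (s - l * h)) • σ (nn l) := by
          funext y; simp only [Finset.sum_apply, Pi.smul_apply]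
        rw [e]
        exact (HasFDerivAt.sum hdl).fderiv
      rw [hD]
      have h1 := AI Φ₁ hΦ₁s.continuous hΦ₁per bM₁ (fun s x y hx => huc₁ s x y (hx.trans hηle₁))
      have h2 := RS hkd hK₀ hK₁ Φ₁ hΦ₁s bM₁ bM₃
      have h3 := ND k hK₀ (fun l => fderiv ℝ (f (l * h)) y) (fun l => fderiv ℝ (σ (nn l)) y)
        (fun l => (hnn l y).2)
      calc ‖fderiv ℝ (f s) y - ∑ l ∈ Finset.range L, (h * k (s - l * h)) • fderiv ℝ (σ (nn l)) y‖
          ≤ ‖Φ₁ s y - ∫ τ in (0 : ℝ)..T, k (s - τ) • Φ₁ τ y‖ +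
              ‖(∫ τ in (0 : ℝ)..T, k (s - τ) • Φ₁ τ y) -
                ∑ l ∈ Finset.range L, h • (k (s - l * h) • Φ₁ (l * h) y)‖ +
              ‖(∑ l ∈ Finset.range L, h • (k (s - l * h) • Φ₁ (l * h) y)) -
                ∑ l ∈ Finset.range L, (h * k (s - l * h)) • fderiv ℝ (σ (nn l)) y‖ :=
            norm_sub_le_of_le_three _ _ _ _
        _ ≤ δ / 2 + δ / 4 + δ / 4 := by
            refine add_le_add (add_le_add ?_ ?_) ?_
            · rw [norm_sub_rev]; exact h1
            · rw [norm_sub_rev]; exact h2.trans hRiem₀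
            · exact h3.trans hδ'K₀
        _ = δ := by ring
    · -- #### time derivatives
      have hD : timeDeriv (fun s y => ∑ l ∈ Finset.range L, (h * k (s - l * h)) • σ (nn l) y) s y =
          ∑ l ∈ Finset.range L, (h * deriv k (s - l * h)) • σ (nn l) y := by
        have hdl : ∀ l ∈ Finset.range L, HasDerivAt (fun t => (h * k (t - l * h)) • σ (nn l) y)
            ((h * deriv k (s - l * h)) • σ (nn l) y) s := fun l _ => by
          have hkat : HasDerivAt (fun t => k (t - l * h)) (deriv k (s - l * h)) s :=
            HasDerivAt.comp_sub_const s (l * h) (hkd (s - l * h)).hasDerivAt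
          exact (hkat.const_mul h).smul_const (σ (nn l) y)
        simp only [timeDeriv]
        have e : (fun t => ∑ l ∈ Finset.range L, (h * k (t - l * h)) • σ (nn l) y) =
            ∑ l ∈ Finset.range L, fun t => (h * k (t - l * h)) • σ (nn l) y := by
          funext t; simp only [Finset.sum_apply]
        rw [e]
        exact (HasDerivAt.sum hdl).deriv
      rw [hD]
      -- integration by parts in time
      have hIBP := integral_deriv_kernel_smul_eq hk1 hkper hfs hper s y
      have h1 := AI Φ₂ hΦ₂s.continuous hΦ₂per bM₂ (fun s x y hx => huc₂ s x y (hx.trans hηle₂))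
      have h2 := RS hk'd hK₁ hK₂ f hfs bM₀ bM₂
      rw [hIBP] at h2
      have h3 := ND (deriv k) hK₁ (fun l => f (l * h) y) (fun l => σ (nn l) y) (fun l => (hnn l y).1)
      calc ‖timeDeriv f s y - ∑ l ∈ Finset.range L, (h * deriv k (s - l * h)) • σ (nn l) y‖
          ≤ ‖Φ₂ s y - ∫ τ in (0 : ℝ)..T, k (s - τ) • Φ₂ τ y‖ +
              ‖(∫ τ in (0 : ℝ)..T, k (s - τ) • Φ₂ τ y) -
                ∑ l ∈ Finset.range L, h • (deriv k (s - l * h) • f (l * h) y)‖ +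
              ‖(∑ l ∈ Finset.range L, h • (deriv k (s - l * h) • f (l * h) y)) -
                ∑ l ∈ Finset.range L, (h * deriv k (s - l * h)) • σ (nn l) y‖ :=
            norm_sub_le_of_le_three _ _ _ _
        _ ≤ δ / 2 + δ / 4 + δ / 4 := by
            refine add_le_add (add_le_add ?_ ?_) ?_
            · rw [norm_sub_rev]; exact h1
            · rw [norm_sub_rev]; exact h2.trans hRiem₁
            · exact h3.trans hδ'K₁
        _ = δ := by ring


set_option maxHeartbeats 1600000 in
/-- **Every `f ∈ 𝒟_T` is approximated, uniformly with `∂ₛf` and `D_y f` and with supports in a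
common ball, by `T`-periodic divergence-free test fields with values in a Galerkin space.** Let
`σ : ℕ → 𝒱` be `C¹`-dense with controlled supports (`exists_countable_dense_testDivFree`) and
`V_m = span{σ₀,…,σ_m}`. Then for every `f ∈ 𝒟_T` and `δ > 0` there are `m` and `g ∈ 𝒟_T` with
`g(s) ∈ V_m` for every `s`, a common radius `R` beyond which `f` and `g` vanish, and
`|f − g|, |D_y f − D_y g|, |∂ₛf − ∂ₛg| ≤ δ` everywhere. Construction: `g(s) = Σ_l h k_n(s − lh) σ_{n_l}`
with the kernel `k_n` of this file, `h = T/L`, and `σ_{n_l}` `C¹`-close to `f(lh)`; see the module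
docstring (Temam, Ch. III §3, the density argument after (3.52), made quantitative and
constructive). [cite: Temam1979, Ch. III §3 (3.50)–(3.52) and the density argument; BradshawTsai2017AHP, proof of Thm 2.4 ("holds for all f ∈ 𝒟_T")] -/
theorem exists_galerkin_test_approx (hT : 0 < T)
    {σ : ℕ → EuclideanSpace ℝ (Fin 3) → EuclideanSpace ℝ (Fin 3)} (hσ : ∀ n, σ n ∈ testDivFreeSubmodule)
    (hσd : ∀ (N : ℕ) (ζ : EuclideanSpace ℝ (Fin 3) → EuclideanSpace ℝ (Fin 3)),
      ζ ∈ testDivFreeSubmodule → tsupport ζ ⊆ closedBall (0 : EuclideanSpace ℝ (Fin 3)) N →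
        ∀ δ : ℝ, 0 < δ → ∃ n, tsupport (σ n) ⊆ closedBall (0 : EuclideanSpace ℝ (Fin 3)) N ∧
          ∀ y, ‖ζ y - σ n y‖ ≤ δ ∧ ‖fderiv ℝ ζ y - fderiv ℝ (σ n) y‖ ≤ δ)
    {f : ℝ → EuclideanSpace ℝ (Fin 3) → EuclideanSpace ℝ (Fin 3)} (hf : IsPeriodicDivFreeTest T f)
    {δ : ℝ} (hδ : 0 < δ) :
    ∃ (m : ℕ) (g : ℝ → EuclideanSpace ℝ (Fin 3) → EuclideanSpace ℝ (Fin 3)),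
      IsPeriodicDivFreeTest T g ∧ (∀ s, g s ∈ galerkinSpace σ m) ∧
      (∃ R : ℝ, ∀ s y, R ≤ ‖y‖ → f s y = 0 ∧ g s y = 0) ∧
      ∀ s y, ‖f s y - g s y‖ ≤ δ ∧ ‖fderiv ℝ (f s) y - fderiv ℝ (g s) y‖ ≤ δ ∧
        ‖timeDeriv f s y - timeDeriv g s y‖ ≤ δ := by
  obtain ⟨R, hfR, h⟩ := exists_galerkin_test_approx_uniform hT hσ hσd hf
  obtain ⟨m, g, h1, h2, h3, h4⟩ := h δ hδ
  exact ⟨m, g, h1, h2, ⟨R, fun s y hy => ⟨hfR s y hy, h3 s y hy⟩⟩, h4⟩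

end Main

end BradshawTsai2017

end Literature.Analysis.FluidPDE

end
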